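import Mathlib

/-!
# `discToCut` — first lemma of the «sfm-bl» line on `CandMatchAvoidLinearFP` (stmt-PneNP-19962)

FRONTIER F-N1c (range avoidance for pure-CAND `NC⁰₃` maps at linear stretch); nothing here bears on P vs NP.

If a real `a × b` matrix `M` has 0/1-discrepancy at most `γ·√(|u|·|v|)` on every pair of 0/1 vectors
`u, v`, then its `±1` bilinear form (the `∞→1` norm without absolute values) is at most `2γ√(ab)`.
This is Lemma 8 (`DiscToCut`) of `PROOF-SFM-BL.md` (pnp-ideate-p3, ROUND-15): the step that turns
Bilu–Linial-type discrepancy control into a bound on the cut-norm certificate `Γ(T)` of a dense spot.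
Elementary: split `σ = u₊ − u₋`, `φ = v₊ − v₋` and use `(√p+√q)(√r+√s) ≤ 2√((p+q)(r+s))`.
-/

namespace Summit.PneNP.PneNP.Theorems

open Matrix Finset

/-- `(√(pr) + √(ps) + √(qr) + √(qs)) ≤ 2√((p+q)(r+s))` for nonnegative reals. -/
theorem sfmBl_sqrt_four_terms {p q r s : ℝ} (hp : 0 ≤ p) (hq : 0 ≤ q) (hr : 0 ≤ r) (hs : 0 ≤ s) :
    Real.sqrt (p * r) + Real.sqrt (p * s) + Real.sqrt (q * r) + Real.sqrt (q * s)
      ≤ 2 * Real.sqrt ((p + q) * (r + s)) := by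
  have hA := Real.sqrt_nonneg p
  have hB := Real.sqrt_nonneg q
  have hC := Real.sqrt_nonneg r
  have hD := Real.sqrt_nonneg s
  have hA2 : Real.sqrt p ^ 2 = p := Real.sq_sqrt hp
  have hB2 : Real.sqrt q ^ 2 = q := Real.sq_sqrt hq
  have hC2 : Real.sqrt r ^ 2 = r := Real.sq_sqrt hr
  have hD2 : Real.sqrt s ^ 2 = s := Real.sq_sqrt hs
  rw [Real.sqrt_mul hp, Real.sqrt_mul hp, Real.sqrt_mul hq, Real.sqrt_mul hq]
  have hlhs : Real.sqrt p * Real.sqrt r + Real.sqrt p * Real.sqrt s + Real.sqrt q * Real.sqrt r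
      + Real.sqrt q * Real.sqrt s = (Real.sqrt p + Real.sqrt q) * (Real.sqrt r + Real.sqrt s) := by ring
  rw [hlhs]
  have hX : (Real.sqrt p + Real.sqrt q) ^ 2 ≤ 2 * (p + q) := by
    nlinarith [sq_nonneg (Real.sqrt p - Real.sqrt q)]
  have hY : (Real.sqrt r + Real.sqrt s) ^ 2 ≤ 2 * (r + s) := by
    nlinarith [sq_nonneg (Real.sqrt r - Real.sqrt s)]
  have hXn : 0 ≤ Real.sqrt p + Real.sqrt q := by positivity
  have hYn : 0 ≤ Real.sqrt r + Real.sqrt s := by positivity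
  have hprod_sq : ((Real.sqrt p + Real.sqrt q) * (Real.sqrt r + Real.sqrt s)) ^ 2
      ≤ 4 * ((p + q) * (r + s)) := by
    have := mul_le_mul hX hY (by positivity) (by positivity)
    calc ((Real.sqrt p + Real.sqrt q) * (Real.sqrt r + Real.sqrt s)) ^ 2
        = (Real.sqrt p + Real.sqrt q) ^ 2 * (Real.sqrt r + Real.sqrt s) ^ 2 := by ring
      _ ≤ 2 * (p + q) * (2 * (r + s)) := this
      _ = 4 * ((p + q) * (r + s)) := by ring
  have hR : 2 * Real.sqrt ((p + q) * (r + s)) = Real.sqrt (4 * ((p + q) * (r + s))) := by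
    rw [Real.sqrt_mul (by norm_num : (0:ℝ) ≤ 4)]
    congr 1
    rw [show (4:ℝ) = 2 ^ 2 by norm_num, Real.sqrt_sq (by norm_num : (0:ℝ) ≤ 2)]
  rw [hR, ← Real.sqrt_sq (mul_nonneg hXn hYn)]
  exact Real.sqrt_le_sqrt hprod_sq

/-- **DiscToCut.** If `|u ⬝ᵥ M v| ≤ γ √(|u| |v|)` for all 0/1 vectors `u, v` (with `|u| = ∑ uᵢ`), then
`|σ ⬝ᵥ M φ| ≤ 2 γ √(a b)` for all `±1` vectors `σ, φ`. -/
theorem sfmBl_discToCut {a b : ℕ} (M : Matrix (Fin a) (Fin b) ℝ) {γ : ℝ} (hγ : 0 ≤ γ)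
    (hD : ∀ (u : Fin a → ℝ) (v : Fin b → ℝ),
      (∀ i, u i = 0 ∨ u i = 1) → (∀ j, v j = 0 ∨ v j = 1) →
        |u ⬝ᵥ (M.mulVec v)| ≤ γ * Real.sqrt ((∑ i, u i) * (∑ j, v j)))
    (σ : Fin a → ℝ) (φ : Fin b → ℝ)
    (hσ : ∀ i, σ i = 1 ∨ σ i = -1) (hφ : ∀ j, φ j = 1 ∨ φ j = -1) :
    |σ ⬝ᵥ (M.mulVec φ)| ≤ 2 * γ * Real.sqrt ((a : ℝ) * (b : ℝ)) := by
  -- positive / negative parts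
  set up : Fin a → ℝ := fun i => if σ i = 1 then 1 else 0 with hup
  set um : Fin a → ℝ := fun i => if σ i = 1 then 0 else 1 with hum
  set vp : Fin b → ℝ := fun j => if φ j = 1 then 1 else 0 with hvp
  set vm : Fin b → ℝ := fun j => if φ j = 1 then 0 else 1 with hvm
  have hup01 : ∀ i, up i = 0 ∨ up i = 1 := by
    intro i; simp only [hup]; split_ifs <;> simp
  have hum01 : ∀ i, um i = 0 ∨ um i = 1 := by
    intro i; simp only [hum]; split_ifs <;> simp
  have hvp01 : ∀ j, vp j = 0 ∨ vp j = 1 := by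
    intro j; simp only [hvp]; split_ifs <;> simp
  have hvm01 : ∀ j, vm j = 0 ∨ vm j = 1 := by
    intro j; simp only [hvm]; split_ifs <;> simp
  have hσeq : σ = up - um := by
    funext i
    simp only [Pi.sub_apply, hup, hum]
    rcases hσ i with h | h
    · simp [h]
    · rw [h]; norm_num
  have hφeq : φ = vp - vm := by
    funext j
    simp only [Pi.sub_apply, hvp, hvm]
    rcases hφ j with h | h
    · simp [h]
    · rw [h]; norm_num
  -- sums
  have hsumA : (∑ i, up i) + (∑ i, um i) = (a : ℝ) := by
    rw [← Finset.sum_add_distrib]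
    have : ∀ i, up i + um i = 1 := by
      intro i; simp only [hup, hum]; split_ifs <;> norm_num
    simp [this]
  have hsumB : (∑ j, vp j) + (∑ j, vm j) = (b : ℝ) := by
    rw [← Finset.sum_add_distrib]
    have : ∀ j, vp j + vm j = 1 := by
      intro j; simp only [hvp, hvm]; split_ifs <;> norm_num
    simp [this]
  have hpn : 0 ≤ ∑ i, up i := Finset.sum_nonneg (fun i _ => by rcases hup01 i with h | h <;> simp [h])
  have hqn : 0 ≤ ∑ i, um i := Finset.sum_nonneg (fun i _ => by rcases hum01 i with h | h <;> simp [h])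
  have hrn : 0 ≤ ∑ j, vp j := Finset.sum_nonneg (fun j _ => by rcases hvp01 j with h | h <;> simp [h])
  have hsn : 0 ≤ ∑ j, vm j := Finset.sum_nonneg (fun j _ => by rcases hvm01 j with h | h <;> simp [h])
  -- expand the bilinear form
  have hexp : σ ⬝ᵥ (M.mulVec φ)
      = up ⬝ᵥ (M.mulVec vp) - up ⬝ᵥ (M.mulVec vm) - (um ⬝ᵥ (M.mulVec vp) - um ⬝ᵥ (M.mulVec vm)) := by
    rw [hσeq, hφeq, Matrix.mulVec_sub, sub_dotProduct, dotProduct_sub, dotProduct_sub]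
  have h1 := hD up vp hup01 hvp01
  have h2 := hD up vm hup01 hvm01
  have h3 := hD um vp hum01 hvp01
  have h4 := hD um vm hum01 hvm01
  have htri : |σ ⬝ᵥ (M.mulVec φ)| ≤ |up ⬝ᵥ (M.mulVec vp)| + |up ⬝ᵥ (M.mulVec vm)|
      + |um ⬝ᵥ (M.mulVec vp)| + |um ⬝ᵥ (M.mulVec vm)| := by
    rw [hexp]
    have e1 := abs_sub (up ⬝ᵥ (M.mulVec vp) - up ⬝ᵥ (M.mulVec vm))
      (um ⬝ᵥ (M.mulVec vp) - um ⬝ᵥ (M.mulVec vm))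
    have e2 := abs_sub (up ⬝ᵥ (M.mulVec vp)) (up ⬝ᵥ (M.mulVec vm))
    have e3 := abs_sub (um ⬝ᵥ (M.mulVec vp)) (um ⬝ᵥ (M.mulVec vm))
    linarith
  have key := sfmBl_sqrt_four_terms hpn hqn hrn hsn
  rw [hsumA, hsumB] at key
  calc |σ ⬝ᵥ (M.mulVec φ)|
      ≤ |up ⬝ᵥ (M.mulVec vp)| + |up ⬝ᵥ (M.mulVec vm)|
        + |um ⬝ᵥ (M.mulVec vp)| + |um ⬝ᵥ (M.mulVec vm)| := htri
    _ ≤ γ * Real.sqrt ((∑ i, up i) * (∑ j, vp j)) + γ * Real.sqrt ((∑ i, up i) * (∑ j, vm j))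
        + γ * Real.sqrt ((∑ i, um i) * (∑ j, vp j)) + γ * Real.sqrt ((∑ i, um i) * (∑ j, vm j)) := by
          linarith
    _ = γ * (Real.sqrt ((∑ i, up i) * (∑ j, vp j)) + Real.sqrt ((∑ i, up i) * (∑ j, vm j))
        + Real.sqrt ((∑ i, um i) * (∑ j, vp j)) + Real.sqrt ((∑ i, um i) * (∑ j, vm j))) := by ring
    _ ≤ γ * (2 * Real.sqrt ((a : ℝ) * (b : ℝ))) := mul_le_mul_of_nonneg_left key hγ
    _ = 2 * γ * Real.sqrt ((a : ℝ) * (b : ℝ)) := by ring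

end Summit.PneNP.PneNP.Theorems
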